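import Summits.BirchSwinnertonDyer.BirchSwinnertonDyer.Theorems.Rank2Observatory2DescClCurveCertE2Q2
import Summits.BirchSwinnertonDyer.BirchSwinnertonDyer.Theorems.ShaPrimaryTransferFiniteShaComponentTransferSelmerCubicDoorTransport
import Summits.BirchSwinnertonDyer.BirchSwinnertonDyer.Theorems.ShaPrimaryTransferFiniteShaComponentTransferSelmerCubicKillSelList
import HarnessLib

/-!
# BirchSwinnertonDyer — the SEL2CUBIC door for the TWO-VIEW TWO-AUXILIARY-PRIME kernel `2`-descent rows
# (`TwoDescCl.checkE2Q r`, kills in residue form): certificate ⟹ `t₂(E) = 0`, `Ш(E/ℚ)[2^∞] = 0`, `rank E(ℚ) = r`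

HONEST FRAMING: route `ShaPrimaryTransfer`, seat `bsd-line-spt-p1` (g31), `--supports` item T =
`FiniteShaComponentTransfer` (stmt-22356), UNCHANGED (conjecture-grade at corank ≥ 2). BSD in rank ≥ 2 is NOT
proved by any of this. THEOREMS ONLY.

The cell-`b2b-bsdr2` two-view kernel `2`-descent over a NON-MONOGENIC complex cubic `2`-division field whose class group
needs two generators (`Rank2Observatory2DescClCurveCertE2Q2{Defs,Sound,Logs,Main}`, `…E2Q2`: field record `ClFieldCertE2Q`
(two views `ℤ[α]`, `ℤ[η]`, multipliers `m₁ = r₁²`, `m₂`), curve record `ClCurveCertE2Q`, sieve `adm2Q` with FOUR valuation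
rows, kills in validity form; soundness `rank_le_of_checkE2Q` GIVEN `KillValidE2Q`). As for every other row shape, the
rational point enters only through the norm/sign clauses, the valuation parities off `F′(e₀)·q₁q₂`, and the kills — and the
tree has all three for `2`-SELMER classes (`admStd_sound_sel`, `valRow_sound_sel`, g29; `admKillsV_sound_sel` with kills in
RESIDUE form, g30). This file runs the SAME certificate on `Sel⁽²⁾(E/ℚ)`:

* `killValidE2Q_of_residue`, `killResidueE2Q_entries` — glue between the residue form and the tree's list certificate;
* **`sha_door_of_checkE2Q`** — `checkE2Q F cc r ks ∧ (residue certs) ∧ r ≤ rank ⟹ t₂(E) = 0 ∧ Ш(E/ℚ)[2^∞] = 0 ∧ rank = r`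
  for the model `(0, A, 0, B, C)`. The `K`-free row shapes (`rank_eq_of_certsE2Q{,_scaled,_complSq,_plain}`; 423 census
  rows in `TwoDescClE2Q2{,R3}Rows*`, 408 of them with an EMPTY kill list, 392 of rank 3) and the row kit are in
  `…SelmerCubicE2QRows`.
[cite: Cassels1991LecturesEllipticCurves, §15] [cite: SilvermanAEC2009, Thm. X.4.2, Rem. X.4.1]
[cite: CremonaAlgorithms1997, §3.6] [cite: Cohen1993, §6.5]
-/

-- single-conjunct summit: `Summit.BirchSwinnertonDyer.BirchSwinnertonDyer.…` repeats the name by design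
set_option linter.dupNamespace false

noncomputable section

open scoped Classical NumberField nonZeroDivisors

open Literature.NumberTheory.NumberFields Literature.NumberTheory.EllipticCurves
  Literature.NumberTheory.GaloisRepresentations Polynomial Module NumberField IsDedekindDomain Ideal
open WeierstrassCurve WeierstrassCurve.Affine

namespace Summit.BirchSwinnertonDyer.BirchSwinnertonDyer.Theorems.ShaPrimaryTransferSelmerCubicCover

open Summit.BirchSwinnertonDyer.BirchSwinnertonDyer.Rank2Observatory
open Summit.BirchSwinnertonDyer.BirchSwinnertonDyer.Rank2Observatory.TwoDescCubic
open Summit.BirchSwinnertonDyer.BirchSwinnertonDyer.Rank2Observatory.TwoDescCl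
open Summit.BirchSwinnertonDyer.BirchSwinnertonDyer.Rank2Observatory.TwoDescCl.ClFieldCertQ2
open Summit.BirchSwinnertonDyer.BirchSwinnertonDyer.Rank2Observatory.TwoDescKill
open Summit.BirchSwinnertonDyer.BirchSwinnertonDyer.Theorems.ShaPrimaryTransferSelmerCubicKill

/-! ## The row door -/

section Row

variable {K : Type} [Field K] [NumberField K] {θ : K}

/-- The kill hypothesis of a two-view two-prime kill row in RESIDUE form implies the tree's integer-validity
`KillValidE2Q` (take the exact zero). [folklore] -/
theorem killValidE2Q_of_residue {F : ClFieldCertE2Q} {cc : ClCurveCertE2Q} {ks : List ClKill}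
    (hk : ∀ k ∈ ks, k.p.Prime ∧ ∃ N : ℕ, ∀ v : ℤ × ℤ × ℤ × ℤ,
      ¬ ((k.p : ℤ) ∣ v.1 ∧ (k.p : ℤ) ∣ v.2.1 ∧ (k.p : ℤ) ∣ v.2.2.1 ∧ (k.p : ℤ) ∣ v.2.2.2) →
      (k.p : ℤ) ^ N ∣ (killQ F.fe.base.a F.fe.base.b F.fe.base.c (k.z2Q F cc) cc.Xt.2.1 cc.Xt.2.2 v).1 →
      (k.p : ℤ) ^ N ∣ (killQ F.fe.base.a F.fe.base.b F.fe.base.c (k.z2Q F cc) cc.Xt.2.1 cc.Xt.2.2 v).2 → False) :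
    KillValidE2Q F cc ks := by
  intro k hkm
  refine ⟨(hk k hkm).1, ?_⟩
  obtain ⟨N, hN⟩ := (hk k hkm).2
  intro v hprim h0
  exact hN v hprim (by rw [h0]; exact dvd_zero _) (by rw [h0]; exact dvd_zero _)

/-- The residue certificates of the `KillEntry`s of a two-view two-prime kill row. [folklore] -/
theorem killResidueE2Q_entries {F : ClFieldCertE2Q} {cc : ClCurveCertE2Q} {ks : List ClKill}
    (hk : ∀ k ∈ ks, k.p.Prime ∧ ∃ N : ℕ, ∀ v : ℤ × ℤ × ℤ × ℤ,
      ¬ ((k.p : ℤ) ∣ v.1 ∧ (k.p : ℤ) ∣ v.2.1 ∧ (k.p : ℤ) ∣ v.2.2.1 ∧ (k.p : ℤ) ∣ v.2.2.2) →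
      (k.p : ℤ) ^ N ∣ (killQ F.fe.base.a F.fe.base.b F.fe.base.c (k.z2Q F cc) cc.Xt.2.1 cc.Xt.2.2 v).1 →
      (k.p : ℤ) ^ N ∣ (killQ F.fe.base.a F.fe.base.b F.fe.base.c (k.z2Q F cc) cc.Xt.2.1 cc.Xt.2.2 v).2 → False) :
    ∀ e ∈ killEntries2Q F cc ks, ∃ N : ℕ, ∀ v : ℤ × ℤ × ℤ × ℤ,
      ¬ ((e.p : ℤ) ∣ v.1 ∧ (e.p : ℤ) ∣ v.2.1 ∧ (e.p : ℤ) ∣ v.2.2.1 ∧ (e.p : ℤ) ∣ v.2.2.2) →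
      (e.p : ℤ) ^ N ∣ (killQ F.fe.base.a F.fe.base.b F.fe.base.c e.z cc.Xt.2.1 cc.Xt.2.2 v).1 →
      (e.p : ℤ) ^ N ∣ (killQ F.fe.base.a F.fe.base.b F.fe.base.c e.z cc.Xt.2.1 cc.Xt.2.2 v).2 → False := by
  intro e he
  obtain ⟨k, hkm, rfl⟩ := List.mem_map.mp he
  exact (hk k hkm).2

/-- **The SEL2CUBIC door for a `checkE2Q r` row (two-view field record over TWO auxiliary primes, kill list in
residue form): `t₂(E) = 0`, `Ш(E/ℚ)[2^∞] = 0`, `rank E(ℚ) = r`.** For a checked two-view two-prime field record `F`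
(non-monogenic complex cubic `2`-division field, class group with two generators), a curve record `cc` and raw kills `ks`
passing `checkE2Q F cc r ks` (model `E = (0, A, 0, B, C)`), the RESIDUE certificate of every listed kill and a lower bound
`r ≤ rank E(ℚ)`: the sieve `admK2Q F cc ks` accepts the Cassels class of every `2`-Selmer class — `admStd_sound_sel`
(norm, sign), four `valRow_sound_sel` (`W₁₁, W₁₂, W₂₁, W₂₂`), and `admKillsV_sound_sel` for the killed classes after
the square rescaling `m₁ = r₁²` — so `#Sel⁽²⁾(E/ℚ) ≤ #admissible < 2^{r+1}` (`natCard_selmerGroup_le_of_coverSet_cl`,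
modulus `M = F′(e₀)·q₁q₂`) and the strict descent count closes. The decoding of the records is the proof of
`rank_le_of_checkE2Q` verbatim (adapted from `Rank2Observatory2DescClCurveCertE2Q2Main`); only the sieve-soundness, kill
and closing steps change (kill step as in g30's `sha_door_of_checkE2KSV`). UNCONDITIONAL; BSD is not claimed.
[cite: Cassels1991LecturesEllipticCurves, §15] [cite: SilvermanAEC2009, Thm. X.4.2, Rem. X.4.1]
[cite: CremonaAlgorithms1997, §3.6] -/
theorem sha_door_of_checkE2Q (r : ℕ) (F : ClFieldCertE2Q)
    (hθ : aeval θ (MonicCubic.poly F.fe.base.a F.fe.base.b F.fe.base.c) = 0) (h3 : finrank ℚ K = 3)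
    (h2 : F.check2 = true) (hpr : F.fe.primeListE.Forall Nat.Prime) (cc : ClCurveCertE2Q) (ks : List ClKill)
    (hc : checkE2Q F cc r ks = true)
    (hk : ∀ k ∈ ks, k.p.Prime ∧ ∃ N : ℕ, ∀ v : ℤ × ℤ × ℤ × ℤ,
      ¬ ((k.p : ℤ) ∣ v.1 ∧ (k.p : ℤ) ∣ v.2.1 ∧ (k.p : ℤ) ∣ v.2.2.1 ∧ (k.p : ℤ) ∣ v.2.2.2) →
      (k.p : ℤ) ^ N ∣ (killQ F.fe.base.a F.fe.base.b F.fe.base.c (k.z2Q F cc) cc.Xt.2.1 cc.Xt.2.2 v).1 →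
      (k.p : ℤ) ^ N ∣ (killQ F.fe.base.a F.fe.base.b F.fe.base.c (k.z2Q F cc) cc.Xt.2.1 cc.Xt.2.2 v).2 → False)
    (hlow : r ≤ ((⟨0, cc.A, 0, cc.B, cc.C⟩ : WeierstrassCurve ℚ)).mordellWeilRank) :
    ((⟨0, cc.A, 0, cc.B, cc.C⟩ : WeierstrassCurve ℚ)).shaCorank 2 = 0 ∧
      AddCommGroup.primaryComponent ((⟨0, cc.A, 0, cc.B, cc.C⟩ : WeierstrassCurve ℚ)).sha 2 = ⊥ ∧
        ((⟨0, cc.A, 0, cc.B, cc.C⟩ : WeierstrassCurve ℚ)).mordellWeilRank = r := by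
  classical
  have hK := F.const_of_check2 h2
  have hEE := F.checkE_of_check2 h2
  have hE := F.fe.checkCoreE_of_checkE hEE
  have hfd := F.fe.checkField_of_checkE hEE
  have hR := F.fe.checkReg_of_coreE hE
  have hprb := F.fe.base_primeList hpr
  have hirr := F.fe.base.irreducible_of_reg hR
  have h0 := (F.fe.base.interval_of_field hfd).1
  have hq₁ := F.fe.base.q₁_prime hprb
  have hq₂ := F.fe.base.q₂_prime hprb
  simp only [checkE2Q, Bool.and_eq_true, decide_eq_true_eq, List.all_eq_true] at hc
  obtain ⟨⟨⟨⟨⟨⟨⟨⟨⟨⟨⟨⟨⟨⟨⟨⟨⟨⟨⟨⟨hΔ, hirrF⟩, hcub⟩, hder⟩, htvX⟩, htvD⟩, hdisc⟩, hND0⟩, hdn⟩, hdnC⟩, hcodes⟩,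
    hdW11⟩, hdW12⟩, hdW21⟩, hdW22⟩, hQ⟩, hhead⟩, hfamAll⟩, hcert⟩, hlite⟩, hcount⟩ := hc
  haveI hEl := isElliptic_of_deltaShort_ne hΔ
  have hirrF' := irreducible_of_noRootMod hirrF
  have hm₁K : (F.m₁ : K) ≠ 0 := m₁_ne_zero_KQ hK
  have hm₁O : (F.m₁ : 𝓞 K) ≠ 0 := m₁_ne_zero_OQ hK
  -- `θ_E = e₀`, root of `F`
  have hXe := m₁_mul_eltOfQ_coe hθ hE hK htvX
  have haevX := aeval_lin_eq_zero_of_coords hθ cc.Xt hcub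
  have haev : aeval (algebraMap (𝓞 K) K (eltOfQ F hθ hE cc.Xt cc.Yt)) (MonicCubic.poly cc.A cc.B cc.C) = 0 := by
    rw [← hXe] at haevX
    simp only [MonicCubic.poly, map_add, map_mul, map_pow, aeval_X, eq_intCast, map_intCast, map_natCast]
      at haevX ⊢
    have h3' : (F.m₁ : K) ^ 3 ≠ 0 := pow_ne_zero 3 hm₁K
    apply mul_right_injective₀ h3'
    simp only [mul_zero]
    linear_combination haevX
  -- `D₀ = F′(e₀)`
  have hderX := deriv_eq_of_coords hθ cc.Xt (smulCoords (F.m₁ : ℤ) cc.XD) [] hder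
  have hderiv : (3 : 𝓞 K) * (eltOfQ F hθ hE cc.Xt cc.Yt) ^ 2 +
      2 * ((cc.A : ℤ) : 𝓞 K) * (eltOfQ F hθ hE cc.Xt cc.Yt) + ((cc.B : ℤ) : 𝓞 K) = eltOfQ F hθ hE cc.XD cc.YD := by
    rw [lin_smulCoords, ← m₁_mul_eltOfQ hθ hE hK htvX, ← m₁_mul_eltOfQ hθ hE hK htvD] at hderX
    simp only [List.map_nil, List.prod_nil, mul_one, Int.cast_mul, Int.cast_pow, Int.cast_natCast] at hderX
    have h2' : (F.m₁ : 𝓞 K) ^ 2 ≠ 0 := pow_ne_zero 2 hm₁O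
    apply mul_right_injective₀ h2'
    simp only
    linear_combination hderX
  have hD0 : eltOfQ F hθ hE cc.XD cc.YD ≠ 0 := eltOfQ_ne_zero hθ h3 hE hK htvD hND0
  have hq0 : ((F.fe.base.q₁ * F.fe.base.q₂ : ℕ) : 𝓞 K) ≠ 0 := by
    exact_mod_cast Nat.mul_ne_zero hq₁.ne_zero hq₂.ne_zero
  have hM0 : eltOfQ F hθ hE cc.XD cc.YD * ((F.fe.base.q₁ * F.fe.base.q₂ : ℕ) : 𝓞 K) ≠ 0 := mul_ne_zero hD0 hq0
  have hgen := closure_tsupp_eq_top_of_dvd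
    (dvd_mul_left ((F.fe.base.q₁ * F.fe.base.q₂ : ℕ) : 𝓞 K) (eltOfQ F hθ hE cc.XD cc.YD))
    (F.fe.closure_q2_eq_top_of_coreE hθ h3 hE hpr)
  have hDM : ∀ v : HeightOneSpectrum (𝓞 K), (3 : 𝓞 K) * (eltOfQ F hθ hE cc.Xt cc.Yt) ^ 2 +
      2 * ((cc.A : ℤ) : 𝓞 K) * (eltOfQ F hθ hE cc.Xt cc.Yt) + ((cc.B : ℤ) : 𝓞 K) ∈ v.asIdeal →
      eltOfQ F hθ hE cc.XD cc.YD * ((F.fe.base.q₁ * F.fe.base.q₂ : ℕ) : 𝓞 K) ∈ v.asIdeal := by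
    intro v hv
    rw [hderiv] at hv
    exact Ideal.mul_mem_right _ _ hv
  -- `D₀ ∉ W₁₁, W₁₂, W₂₁, W₂₂` (read on `X_D`)
  have hDW : ∀ W : HeightOneSpectrum (𝓞 K), lin hθ cc.XD.1 cc.XD.2.1 cc.XD.2.2 ∉ W.asIdeal →
      eltOfQ F hθ hE cc.XD cc.YD ∉ W.asIdeal := fun W hX h =>
    hX (by rw [← m₁_mul_eltOfQ hθ hE hK htvD]; exact Ideal.mul_mem_left _ _ h)
  have hDW₁₁ := hDW _ (lin_not_mem_of_invCert hθ _ (W₁₁r_asIdeal hθ h3 hR hprb) hdW11)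
  have hDW₁₂ := hDW _ (lin_not_mem_of_invCert hθ _ (W₁₂r_asIdeal hθ h3 hR hprb) hdW12)
  have hDW₂₁ := hDW _ (lin_not_mem_of_invCert hθ _ (W₂₁r_asIdeal hθ h3 hR hprb) hdW21)
  have hDW₂₂ := hDW _ (lin_not_mem_of_invCert hθ _ (W₂₂r_asIdeal hθ h3 hR hprb) hdW22)
  -- the support `T = {W₁₁, W₁₂, W₂₁, W₂₂} ∪ code primes`
  set L := cc.codes.length with hL
  let Tf : Fin (L + 4) → HeightOneSpectrum (𝓞 K) := Matrix.vecCons (F.fe.base.W₁₁r hθ h3 hR hprb)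
    (Matrix.vecCons (F.fe.base.W₁₂r hθ h3 hR hprb) (Matrix.vecCons (F.fe.base.W₂₁r hθ h3 hR hprb)
      (Matrix.vecCons (F.fe.base.W₂₂r hθ h3 hR hprb) fun i => codePrime2Q F hθ h3 hE hpr (cc.codes.get i))))
  have hT : ∀ w : HeightOneSpectrum (𝓞 K),
      eltOfQ F hθ hE cc.XD cc.YD * ((F.fe.base.q₁ * F.fe.base.q₂ : ℕ) : 𝓞 K) ∈ w.asIdeal → ∃ i, Tf i = w := by
    intro w hw
    have hqw : ((F.fe.base.q₁ : ℕ) : 𝓞 K) ∈ w.asIdeal ∨ ((F.fe.base.q₂ : ℕ) : 𝓞 K) ∈ w.asIdeal →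
        ∃ i, Tf i = w := fun hqw => by
      rcases hqw with h₁ | h₂
      · rcases eq_W₁₁r_or_W₁₂r hθ h3 hR hprb w h₁ with rfl | rfl
        · exact ⟨0, by simp [Tf]⟩
        · exact ⟨1, by simp [Tf]⟩
      · rcases eq_W₂₁r_or_W₂₂r hθ h3 hR hprb w h₂ with rfl | rfl
        · exact ⟨2, by simp [Tf]⟩
        · exact ⟨3, by simp [Tf]⟩
    rcases w.isPrime.mem_or_mem hw with hD | hq'
    · obtain ⟨hXv, hYv⟩ := avatars_memQ hθ hE hK htvD w hD
      obtain ⟨pe, hpe, hpv⟩ := exists_prime_of_memQ hθ h3 hE hND0 hdn w hXv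
      rcases dispatch_soundQ (cc := cc) hθ h3 hE hK hpr (hdnC pe hpe) w hpv hXv hYv with
        hq'' | ⟨C, hmem, hany, hC, hw', -⟩ | ⟨C, hmem, hany, hC, hw', -⟩
      · exact hqw hq''
      · obtain ⟨bc, hbc, hbc1⟩ := List.mem_map.mp hmem
        obtain ⟨i, hi⟩ := List.mem_iff_get.mp hbc
        refine ⟨i.succ.succ.succ.succ, HeightOneSpectrum.ext ?_⟩
        simp only [Tf, Matrix.cons_val_succ]
        rw [hi, codePrime2Q, if_pos (by rw [hbc1]), show bc.1.2 = C by rw [hbc1],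
          codePrimeR_asIdeal hθ h3 hR hprb hany hC, hw']
      · obtain ⟨bc, hbc, hbc1⟩ := List.mem_map.mp hmem
        obtain ⟨i, hi⟩ := List.mem_iff_get.mp hbc
        refine ⟨i.succ.succ.succ.succ, HeightOneSpectrum.ext ?_⟩
        simp only [Tf, Matrix.cons_val_succ]
        rw [hi, codePrime2Q, if_neg (by rw [hbc1]; exact Bool.false_ne_true), show bc.1.2 = C by rw [hbc1],
          ClFieldCertEQ.codePrimeEta_asIdeal hθ h3 hE hpr hany hC, hw']
    · rw [natCast_q₁q₂] at hq'
      exact hqw (w.isPrime.mem_or_mem hq')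
  -- the family
  set fm := fam2Q cc with hfm
  let W : Fin fm.length → 𝓞 K := fun j => eltOfQ F hθ hE (fm.get j).X (fm.get j).Y
  have hfam : ∀ j : Fin fm.length, famCheckE2Q F cc (fm.get j) = true := fun j => hfamAll _ (List.get_mem _ j)
  have hW0 : ∀ j, W j ≠ 0 := fun j =>
    eltOfQ_ne_zero hθ h3 hE hK (tv_of_famCheckE2Q (hfam j)) (normFormZ_ne_of_famCheckE2Q (hfam j))
  have hWval : ∀ j (v : HeightOneSpectrum (𝓞 K)),
      eltOfQ F hθ hE cc.XD cc.YD * ((F.fe.base.q₁ * F.fe.base.q₂ : ℕ) : 𝓞 K) ∉ v.asIdeal →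
        v.valuation K (algebraMap (𝓞 K) K (W j)) = 1 :=
    fun j v hv => valuation_eq_one_of_support _ _ (supp_of_famCheckE2Q hθ h3 hE hK hpr hcodes htvD (hfam j)) v hv
  obtain ⟨ρ, hlo, hhi⟩ := F.fe.base.exists_rho_of_field hθ h3 hfd
  -- independence modulo squares: the parity certificate (rows computed on `X = m₁ x`, `m₁` a square)
  have hrow : ∀ (Wp : HeightOneSpectrum (𝓞 K)) (Lf : FamEntry2Q → ℤ),
      (∀ j, WithZero.log (Wp.valuation K ((W j : 𝓞 K) : K)) = Lf (fm.get j)) →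
      ∀ j, ((!decide ((2 : ℤ) ∣ Lf (fm.get j))) = true ↔ ¬ 2 ∣ WithZero.log (Wp.valuation K ((W j : 𝓞 K) : K))) :=
    fun Wp Lf hlog j => by rw [hlog j]; simp
  have hr₁₁ := hrow _ famL₁₁Q fun j => log_W₁₁r_of_famCheckE2Q hθ h3 hE hK hpr (hfam j)
  have hr₁₂ := hrow _ famL₁₂Q fun j => log_W₁₂r_of_famCheckE2Q hθ h3 hE hK hpr (hfam j)
  have hr₂₁ := hrow _ famL₂₁Q fun j => log_W₂₁r_of_famCheckE2Q hθ h3 hE hK hpr (hfam j)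
  have hr₂₂ := hrow _ famL₂₂Q fun j => log_W₂₂r_of_famCheckE2Q hθ h3 hE hK hpr (hfam j)
  have hind : ∀ S : Finset (Fin fm.length), IsSquare (∏ i ∈ S, algebraMap (𝓞 K) K (W i)) → S = ∅ := by
    intro S hS
    refine indep_of_parity_certificate (fun i => algebraMap (𝓞 K) K (W i)) (bit2Q F cc) ?_ hcert S hS
    intro k S' hS'
    have hS'' : IsSquare (∏ i ∈ S', W i) := isSquare_prod_of_isSquare_prod_coe _ hS'
    obtain ⟨k, hk⟩ := k
    rcases k with _ | _ | _ | _ | _ | k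
    · have h := even_card_of_isSquare_real ρ (fun i => algebraMap (𝓞 K) K (W i))
        (fun i => rho_ne_zero_of_famCheckE2Q hθ ρ hlo hhi h0 hE hK (hfam i)) hS'
      convert h using 2
      refine Finset.filter_congr (fun i _ => ?_)
      exact sign_iff_of_famCheckE2Q hθ ρ hlo hhi h0 hE hK (hfam i)
    · exact even_card_of_isSquare_valuation (F.fe.base.W₁₁r hθ h3 hR hprb) W hW0 _ hr₁₁ hS'
    · exact even_card_of_isSquare_valuation (F.fe.base.W₁₂r hθ h3 hR hprb) W hW0 _ hr₁₂ hS'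
    · exact even_card_of_isSquare_valuation (F.fe.base.W₂₁r hθ h3 hR hprb) W hW0 _ hr₂₁ hS'
    · exact even_card_of_isSquare_valuation (F.fe.base.W₂₂r hθ h3 hR hprb) W hW0 _ hr₂₂ hS'
    · have hk' : k < F.fe.base.chars.length := by omega
      have hch : F.fe.base.chars.getD k ((3 : ℕ), (0 : ℤ), (0 : ℤ)) ∈ F.fe.base.chars := by
        rw [List.getD_eq_getElem?_getD, List.getElem?_eq_getElem hk', Option.getD_some]
        exact List.getElem_mem hk'
      obtain ⟨h2', ψ, hψ⟩ := F.fe.base.exists_psi_of_reg hθ h3 hR hprb hch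
      haveI : Fact (F.fe.base.chars.getD k (3, 0, 0)).1.Prime := ⟨F.fe.base.char_prime hprb hch⟩
      have hSX : IsSquare (∏ i ∈ S', lin hθ (fm.get i).X.1 (fm.get i).X.2.1 (fm.get i).X.2.2) := by
        have e1 : ∀ i ∈ S', lin hθ (fm.get i).X.1 (fm.get i).X.2.1 (fm.get i).X.2.2 = (F.m₁ : 𝓞 K) * W i :=
          fun i _ => (m₁_mul_eltOfQ hθ hE hK (tv_of_famCheckE2Q (hfam i))).symm
        rw [Finset.prod_congr rfl e1, Finset.prod_mul_distrib, Finset.prod_const]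
        obtain ⟨z, hz⟩ := hS''
        refine ⟨(F.r₁ : 𝓞 K) ^ S'.card * z, ?_⟩
        rw [hz]
        simp only [ClFieldCertE2Q.m₁, Nat.cast_pow]
        ring
      have h := even_card_filter_eulerBit hθ (ℓ := (F.fe.base.chars.getD k (3, 0, 0)).1) (by omega) ψ hψ
        (fun i => (fm.get i).X) (fun i => not_dvd_evalInt_of_famCheckE2Q (hfam i) hch) hSX
      convert h using 2
      exact Finset.filter_congr (fun i _ => Iff.rfl)
  -- spanning of the `T`-units modulo squares
  have hodd : Odd (finrank ℚ K) := by rw [h3]; decide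
  have hn : fm.length = NumberField.Units.rank K + 1 + (L + 4) := by
    rw [F.fe.base.units_rank_of_field hθ h3 hfd]
    simp only [hfm, fam2Q, List.length_append, List.length_map, hL, hhead]
    omega
  have hspan : ∀ u : K, u ≠ 0 →
      (∀ v : HeightOneSpectrum (𝓞 K),
        eltOfQ F hθ hE cc.XD cc.YD * ((F.fe.base.q₁ * F.fe.base.q₂ : ℕ) : 𝓞 K) ∉ v.asIdeal →
          v.valuation K u = 1) →
      ∃ U : Finset (Fin fm.length), IsSquare (u * ∏ j ∈ U, algebraMap (𝓞 K) K (W j)) :=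
    fun u hu huT => exists_isSquare_tunit_mul_prod hodd _ Tf hT hn (fun j => algebraMap (𝓞 K) K (W j))
      (fun j => RingOfIntegers.coe_ne_zero_iff.mpr (hW0 j)) hWval hind u hu huT
  -- the sieve is sound at rational points
  haveI hEK : (((⟨0, cc.A, 0, cc.B, cc.C⟩ : WeierstrassCurve ℚ)).baseChange K).IsElliptic := ((⟨0, cc.A, 0, cc.B, cc.C⟩ : WeierstrassCurve ℚ)).isElliptic_baseChange K
  have hΔneg : ((⟨0, cc.A, 0, cc.B, cc.C⟩ : WeierstrassCurve ℚ)).Δ < 0 := by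
    rw [Δ_shortModel_eq_sixteen_mul_disc]
    exact_mod_cast (show 16 * MonicCubic.disc cc.A cc.B cc.C < 0 by linarith [hdisc])
  have hadm : ∀ c ∈ selmerGroup ((⟨0, cc.A, 0, cc.B, cc.C⟩ : WeierstrassCurve ℚ)) 2, ∀ a : Kˣ,
      kummerEquiv K 2 (((⟨0, cc.A, 0, cc.B, cc.C⟩ : WeierstrassCurve ℚ)).oneRootDescentH1 K
        (isTwoTorsionX_of_aeval (A := cc.A) (B := cc.B) (C := cc.C) ((⟨0, cc.A, 0, cc.B, cc.C⟩ : WeierstrassCurve ℚ)) rfl rfl rfl rfl rfl haev) c) =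
        Additive.ofMul (QuotientGroup.mk a) →
      ∀ (T : Finset (Fin 0)) (U : Finset (Fin fm.length)),
        IsSquare ((a : K) *
          (∏ i ∈ T, algebraMap (𝓞 K) K (((fun i : Fin 0 => i.elim0 : Fin 0 → (𝓞 K)ˣ) i : (𝓞 K)ˣ) : 𝓞 K)) *
            ∏ j ∈ U, algebraMap (𝓞 K) K (W j)) → adm2Q F cc T U = true := by
    intro c hc a ha T U hsq
    have h1 : admStd (fun i : Fin 0 => i.elim0) (famNorm2Q F cc) (fun i : Fin 0 => i.elim0) (famSign2Q cc) T U =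
        true :=
      admStd_sound_sel (A := cc.A) (B := cc.B) (C := cc.C) ((⟨0, cc.A, 0, cc.B, cc.C⟩ : WeierstrassCurve ℚ)) rfl rfl rfl rfl rfl hirrF' haev h3 ρ hΔneg (w := fun i : Fin 0 => algebraMap (𝓞 K) K
          (((fun i : Fin 0 => i.elim0 : Fin 0 → (𝓞 K)ˣ) i : (𝓞 K)ˣ) : 𝓞 K))
        (g := fun j => algebraMap (𝓞 K) K (W j)) (fun i => i.elim0)
        (fun j => RingOfIntegers.coe_ne_zero_iff.mpr (hW0 j)) (fun i => i.elim0)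
        (fun j => norm_eltOfQ hθ h3 hE hK (tv_of_famCheckE2Q (hfam j)) (dvd_of_famCheckE2Q (hfam j)))
        (fun i => i.elim0)
        (fun j => sign_iff_of_famCheckE2Q hθ ρ hlo hhi h0 hE hK (hfam j)) hc a ha T U hsq
    have hv := fun (Wp : HeightOneSpectrum (𝓞 K)) (hDWp : eltOfQ F hθ hE cc.XD cc.YD ∉ Wp.asIdeal) (k : ℕ)
        (hr : ∀ j, (bitRow2Q F.fe.base (fm.get j) k = true ↔
          ¬ 2 ∣ WithZero.log (Wp.valuation K ((W j : 𝓞 K) : K)))) =>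
      valRow_sound_sel (A := cc.A) (B := cc.B) (C := cc.C) ((⟨0, cc.A, 0, cc.B, cc.C⟩ : WeierstrassCurve ℚ)) rfl rfl rfl rfl rfl haev
        Wp (by rw [hderiv]; exact hDWp) hW0 (r := fun j => bitRow2Q F.fe.base (fm.get j) k)
        hr hc a ha T U hsq
    simp only [adm2Q, Bool.and_eq_true]
    exact ⟨⟨⟨⟨admStdQ_of_admStd hQ h1, hv _ hDW₁₁ 1 hr₁₁⟩, hv _ hDW₁₂ 2 hr₁₂⟩, hv _ hDW₂₁ 3 hr₂₁⟩,
      hv _ hDW₂₂ 4 hr₂₂⟩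
  -- the killed classes: rescale `∏_{j ∈ U} X_j(θ) = m₁^{#U} · ∏_{j ∈ U} W_j`, `m₁ = r₁²`, then
  -- `admKillsV_sound_sel` over the `X`-coordinates of the family (no separate units), root `e₀ = X_t(θ)/m₁`
  have he₀ : (F.r₁ : K) ^ 2 * algebraMap (𝓞 K) K (eltOfQ F hθ hE cc.Xt cc.Yt) = evZ θ (cc.Xt.1, cc.Xt.2.1, cc.Xt.2.2) := by
    rw [← algebraMap_lin_evZ hθ (cc.Xt.1, cc.Xt.2.1, cc.Xt.2.2), ← hXe, ClFieldCertE2Q.m₁, Nat.cast_pow]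
  have hkill := killListCheckV_of_liteV2Q hlite (killValidE2Q_of_residue hk)
  have hadmK : ∀ c ∈ selmerGroup ((⟨0, cc.A, 0, cc.B, cc.C⟩ : WeierstrassCurve ℚ)) 2, ∀ a : Kˣ,
      kummerEquiv K 2 (((⟨0, cc.A, 0, cc.B, cc.C⟩ : WeierstrassCurve ℚ)).oneRootDescentH1 K
        (isTwoTorsionX_of_aeval (A := cc.A) (B := cc.B) (C := cc.C) ((⟨0, cc.A, 0, cc.B, cc.C⟩ : WeierstrassCurve ℚ)) rfl rfl rfl rfl rfl haev) c) =
        Additive.ofMul (QuotientGroup.mk a) →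
      ∀ (T : Finset (Fin 0)) (U : Finset (Fin fm.length)),
        IsSquare ((a : K) *
          (∏ i ∈ T, algebraMap (𝓞 K) K (((fun i : Fin 0 => i.elim0 : Fin 0 → (𝓞 K)ˣ) i : (𝓞 K)ˣ) : 𝓞 K)) *
            ∏ j ∈ U, algebraMap (𝓞 K) K (W j)) → admK2Q F cc ks T U = true := by
    intro c hc a ha T U hsq
    have hsq' : IsSquare ((a : K) *
        (∏ i ∈ T, algebraMap (𝓞 K) K (((fun i : Fin 0 => i.elim0 : Fin 0 → (𝓞 K)ˣ) i : (𝓞 K)ˣ) : 𝓞 K)) *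
          ∏ j ∈ U, algebraMap (𝓞 K) K (lin hθ (fm.get j).X.1 (fm.get j).X.2.1 (fm.get j).X.2.2)) := by
      have e1 : ∀ j ∈ U, algebraMap (𝓞 K) K (lin hθ (fm.get j).X.1 (fm.get j).X.2.1 (fm.get j).X.2.2) =
          (F.m₁ : K) * algebraMap (𝓞 K) K (W j) :=
        fun j _ => (m₁_mul_eltOfQ_coe hθ hE hK (tv_of_famCheckE2Q (hfam j))).symm
      rw [Finset.prod_congr rfl e1, Finset.prod_mul_distrib, Finset.prod_const]
      obtain ⟨w, hw⟩ := hsq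
      have hm : (F.m₁ : K) ^ U.card = ((F.r₁ : K) ^ U.card) ^ 2 := by
        rw [ClFieldCertE2Q.m₁, Nat.cast_pow, ← pow_mul, ← pow_mul, Nat.mul_comm]
      refine ⟨(F.r₁ : K) ^ U.card * w, ?_⟩
      calc (a : K) *
            (∏ i ∈ T, algebraMap (𝓞 K) K (((fun i : Fin 0 => i.elim0 : Fin 0 → (𝓞 K)ˣ) i : (𝓞 K)ˣ) : 𝓞 K)) *
              ((F.m₁ : K) ^ U.card * ∏ j ∈ U, algebraMap (𝓞 K) K (W j))
          = (F.m₁ : K) ^ U.card * ((a : K) *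
              (∏ i ∈ T, algebraMap (𝓞 K) K
                (((fun i : Fin 0 => i.elim0 : Fin 0 → (𝓞 K)ˣ) i : (𝓞 K)ˣ) : 𝓞 K)) *
                ∏ j ∈ U, algebraMap (𝓞 K) K (W j)) := by ring
        _ = ((F.r₁ : K) ^ U.card) ^ 2 * (w * w) := by rw [hm, hw]
        _ = (F.r₁ : K) ^ U.card * w * ((F.r₁ : K) ^ U.card * w) := by ring
    exact admKillsV_sound_sel (A := cc.A) (B := cc.B) (C := cc.C) hirr hθ h3
      ((⟨0, cc.A, 0, cc.B, cc.C⟩ : WeierstrassCurve ℚ)) rfl rfl rfl rfl rfl (eltOfQ F hθ hE cc.Xt cc.Yt) haev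
      cc.Xt.1 F.r₁ he₀
      (u := fun i : Fin 0 => (((fun i : Fin 0 => i.elim0 : Fin 0 → (𝓞 K)ˣ) i : (𝓞 K)ˣ) : 𝓞 K))
      (fun j => lin hθ (fm.get j).X.1 (fm.get j).X.2.1 (fm.get j).X.2.2)
      (cu := noUnitCoords) (cg := famCoords2Q cc) (fun i => i.elim0) (fun j => rfl) hkill
      (killResidueE2Q_entries hk) (hadm c hc a ha T U hsq) hc a ha hsq'
  have hsel := natCard_selmerGroup_le_of_coverSet_cl (A := cc.A) (B := cc.B) (C := cc.C)
    ((⟨0, cc.A, 0, cc.B, cc.C⟩ : WeierstrassCurve ℚ)) rfl rfl rfl rfl rfl hirrF' haev h3 hM0 hgen hDM hW0 hspan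
    (Wu := fun i : Fin 0 => i.elim0) (adm := admK2Q F cc ks) hadmK
  exact sha_door_of_natCard_selmerGroup_two_lt ((⟨0, cc.A, 0, cc.B, cc.C⟩ : WeierstrassCurve ℚ)) (hsel.trans_lt hcount) hlow

end Row

end Summit.BirchSwinnertonDyer.BirchSwinnertonDyer.Theorems.ShaPrimaryTransferSelmerCubicCover

end
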